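import Summits.Parity.GeneralizedHardyLittlewood.Theorems.BeyondDiagonalBeatsQuarter.OffDiagHeartCore
import Summits.Parity.GeneralizedHardyLittlewood.Theorems.BeyondDiagonalBeatsQuarter.OffDiagBlockSwitch
import Summits.Parity.GeneralizedHardyLittlewood.Theorems.BeyondDiagonalBeatsQuarter.OffDiagCoreSplit
import HarnessLib

/-!
# Route `PrimeLevelFamEdge`, crux K_B (stmt-Parity-20343), line `diagonal_kernel_split` rev 4, plan Ω (lead KEYS 17:00Z,
# node `OffDiagCoreRanges` for `OffDiagCoreSplit`) — **q-free RANGE ENLARGEMENT of the finite core: every level-dependent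
# index range of `offDiagCore`'s nest is contained in its value at the top of the block, so `Σ_{q ∈ G}` moves INSIDE the
# `(r, l, m, d₁, d₂, i)`-sums with the membership indicators folded into the weight**

The finite dual core `OffDiag.offDiagCore Hf Δ′ q` (p641979) and its block split `OffDiagCoreSplit.levelBody q Δ′ T`
(prover-6) are, per level `q`, the nest
`−re(P(q)·Σ_{r < q⁷} Σ_{l,m ∈ Icc 1 ⌊q̂(q)^{Δ′}⌋} C_q(l,m)·Σ_{d₁∣l, d₂∣m} Σ_{i ∈ nearBoxes q d₁ d₂ (log q)⁴} T_q(r,l,m,d₁,d₂,i))`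
whose RANGES depend on the level. The consumers of the split (L7d part 2 for `coreL_R`, A8P for `coreP`) need the level sum
innermost — `Σ_{idx} Σ_{q ∈ G} 𝟙[idx ∈ ranges(q)]·…` — so that for a fixed index the `q`-sum is a level sum in a class
(`levelAPSum` & co.). This file supplies exactly that exchange:

* monotonicity of the ranges in the level (`q ≤ Q`, e.g. `Q = 2N` for a block `G ⊆ (N, 2N]`): `qhat_mono`,
  `range_pow_subset` (`r < q⁷ ⇒ r < Q⁷`), `Icc_floor_qhat_rpow_subset` (`l ≤ ⌊q̂(q)^{Δ′}⌋ ⇒ l ≤ ⌊q̂(Q)^{Δ′}⌋`, `Δ′ ≥ 0`),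
  `nearBoxes_mono` / **`nearBoxes_log_subset`** (`nearBoxes q d₁ d₂ (log q)⁴ ⊆ nearBoxes Q d₁ d₂ (log Q)⁴`), and for the dual
  modulus `sum_Icc_eq_sum_Icc_ite_sup` (`|h₁| ≤ Hf q ⇒ |h₁| ≤ H* := sup_{q ∈ G} Hf q`, via S3's `sum_Icc_eq_sum_Icc_ite_of_le`);
  block facts `one_le_and_le_two_mul_of_mem_goodPrimes`;
* generic exchange: `sum_eq_sum_ite_of_subset`, **`sum_sum_eq_sum_sum_ite_of_subset`** / `…_filter_of_subset`
  (`Σ_{q∈G} Σ_{x∈I q} f q x = Σ_{x∈J} Σ_{q∈G} 𝟙[x ∈ I q]·f q x` for `I q ⊆ J`), `sum_neg_re_mul` (the `−re(P·S)` shape);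
* the core nest: **`coreNest_eq_enlarged`** (one level `q ≤ Q`: the nest over the `q`-ranges = the nest over the `Q`-ranges of
  `𝟙[r < q⁷ ∧ l, m ≤ ⌊q̂(q)^{Δ′}⌋ ∧ i ∈ nearBoxes q …]·C·T`), `sum_levels_coreNest_exchange` (q-free ranges: `Σ_q −re(P q·nest)
  = −re(nest of Σ_q P q·…)`), and the assembled **`sum_levels_coreNest_eq_enlarged`** for any finite set of levels `G` with
  `1 ≤ q ≤ Q` on `G` — abstract `P, C, T`, so `offDiagCore` (T = the truncated dual series) and `levelBody` (T = a switched
  cell) instantiate it by unfolding.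

Finite-sum bookkeeping only; theorems only; standard axioms. Helper toward `stub_offDiagBelowSlack_io`; closes nothing.
«The programme SEARCHES and TYPES; no claim about Landau–Siegel zeros, Theorems 1–2 of arXiv:2211.02515 or
a repaired Margin232 until a kernel theorem says so.»
-/

noncomputable section

open Finset Polynomial
open scoped Real

namespace Summit.Parity.GeneralizedHardyLittlewood.Theorems.BeyondDiagonalBeatsQuarter.OffDiag

open Literature.NumberTheory.LFunctions Literature.NumberTheory.LFunctions.KMV2000
open PeterssonSplit (nearBoxes)

/-! ### Monotonicity of the level-dependent ranges -/

/-- `q̂ = √q/(2π) ≥ 0`. [cite: KowalskiMichelVanderKam2000, §1 p. 1 (definition of q̂)] -/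
theorem qhat_nonneg (q : ℕ) : 0 ≤ qhat q := by
  unfold qhat; positivity

/-- `q̂` is monotone in the level. [cite: KowalskiMichelVanderKam2000, §1 p. 1 (definition of q̂)] -/
theorem qhat_mono {q Q : ℕ} (h : q ≤ Q) : qhat q ≤ qhat Q := by
  unfold qhat
  exact div_le_div_of_nonneg_right (Real.sqrt_le_sqrt (by exact_mod_cast h)) (by positivity)

/-- The layer range: `r < q^k ⇒ r < Q^k` for `q ≤ Q`. [folklore] -/
theorem range_pow_subset {q Q : ℕ} (h : q ≤ Q) (k : ℕ) : Finset.range (q ^ k) ⊆ Finset.range (Q ^ k) :=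
  Finset.range_mono (Nat.pow_le_pow_left h k)

/-- The mollifier length is monotone in the level: `⌊q̂(q)^{Δ′}⌋ ≤ ⌊q̂(Q)^{Δ′}⌋` for `q ≤ Q`, `Δ′ ≥ 0`. [folklore] -/
theorem floor_qhat_rpow_mono {q Q : ℕ} (h : q ≤ Q) {Δ' : ℝ} (hΔ : 0 ≤ Δ') :
    ⌊qhat q ^ Δ'⌋₊ ≤ ⌊qhat Q ^ Δ'⌋₊ :=
  Nat.floor_mono (Real.rpow_le_rpow (qhat_nonneg q) (qhat_mono h) hΔ)

/-- The mollifier range: `Icc 1 ⌊q̂(q)^{Δ′}⌋ ⊆ Icc 1 ⌊q̂(Q)^{Δ′}⌋` for `q ≤ Q`, `Δ′ ≥ 0`. [folklore] -/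
theorem Icc_floor_qhat_rpow_subset {q Q : ℕ} (h : q ≤ Q) {Δ' : ℝ} (hΔ : 0 ≤ Δ') :
    Finset.Icc 1 ⌊qhat q ^ Δ'⌋₊ ⊆ Finset.Icc 1 ⌊qhat Q ^ Δ'⌋₊ :=
  Finset.Icc_subset_Icc_right (floor_qhat_rpow_mono h hΔ)

/-- `nearBoxes` is monotone in its threshold `4q̂²y₀`. [folklore] -/
theorem nearBoxes_mono {q Q d₁ d₂ : ℕ} {y₀ y₀' : ℝ} (h : 4 * qhat q ^ 2 * y₀ ≤ 4 * qhat Q ^ 2 * y₀') :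
    nearBoxes q d₁ d₂ y₀ ⊆ nearBoxes Q d₁ d₂ y₀' := by
  intro i hi
  unfold PeterssonSplit.nearBoxes at hi ⊢
  simp only [Finset.mem_filter, Finset.mem_product, Finset.mem_range] at hi ⊢
  obtain ⟨⟨h1, h2⟩, h3⟩ := hi
  have hc : ⌈4 * qhat q ^ 2 * y₀⌉₊ ≤ ⌈4 * qhat Q ^ 2 * y₀'⌉₊ := Nat.ceil_mono h
  exact ⟨⟨lt_of_lt_of_le h1 hc, lt_of_lt_of_le h2 hc⟩, fun h' ↦ h3 (h.trans h')⟩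

/-- `(log q)⁴ ≤ (log Q)⁴` for `1 ≤ q ≤ Q`. [folklore] -/
theorem log_pow_four_mono {q Q : ℕ} (hq : 1 ≤ q) (h : q ≤ Q) : Real.log q ^ 4 ≤ Real.log Q ^ 4 :=
  pow_le_pow_left₀ (Real.log_natCast_nonneg q)
    (Real.log_le_log (by exact_mod_cast hq) (by exact_mod_cast h)) 4

/-- **The near-box range is monotone in the level**: `nearBoxes q d₁ d₂ (log q)⁴ ⊆ nearBoxes Q d₁ d₂ (log Q)⁴` for
`1 ≤ q ≤ Q`. [folklore] -/
theorem nearBoxes_log_subset {q Q : ℕ} (hq : 1 ≤ q) (h : q ≤ Q) (d₁ d₂ : ℕ) :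
    nearBoxes q d₁ d₂ (Real.log q ^ 4) ⊆ nearBoxes Q d₁ d₂ (Real.log Q ^ 4) := by
  refine nearBoxes_mono ?_
  have h1 : qhat q ^ 2 ≤ qhat Q ^ 2 := pow_le_pow_left₀ (qhat_nonneg q) (qhat_mono h) 2
  have h2 := log_pow_four_mono hq h
  have h3 : 0 ≤ Real.log (q : ℝ) ^ 4 := by positivity
  have h4 : 0 ≤ qhat Q ^ 2 := by positivity
  exact mul_le_mul (mul_le_mul_of_nonneg_left h1 (by norm_num)) h2 h3 (by positivity)

/-- **The dual-modulus range**: for `q ∈ G` the sum over `|h₁| ≤ H q` is the sum over `|h₁| ≤ H* := sup_{q ∈ G} H q` of the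
indicator-weighted summand (S3's `sum_Icc_eq_sum_Icc_ite_of_le` at `H q ≤ H*`). [folklore] -/
theorem sum_Icc_eq_sum_Icc_ite_sup {M : Type*} [AddCommMonoid M] (G : Finset ℕ) (H : ℕ → ℕ) {q : ℕ} (hq : q ∈ G)
    (f : ℤ → M) :
    ∑ h₁ ∈ Finset.Icc (-(H q : ℤ)) (H q), f h₁ =
      ∑ h₁ ∈ Finset.Icc (-((G.sup H : ℕ) : ℤ)) ((G.sup H : ℕ) : ℤ), (if |h₁| ≤ (H q : ℤ) then f h₁ else 0) :=
  sum_Icc_eq_sum_Icc_ite_of_le (Finset.le_sup hq) f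

/-- Block facts: a good prime of the block `(N, 2N]` satisfies `1 ≤ q ≤ 2N`. [cite: KowalskiMichelVanderKam2000, §2 p. 7 (M ∉ ℤ)] -/
theorem one_le_and_le_two_mul_of_mem_goodPrimes {Δ' : ℝ} {N q : ℕ} (hq : q ∈ goodPrimes Δ' N) :
    1 ≤ q ∧ q ≤ 2 * N := by
  obtain ⟨h1, h2, hp, -⟩ := mem_goodPrimes_iff.mp hq
  exact ⟨hp.one_lt.le, h2⟩

/-! ### Generic exchange of a level sum with a level-dependent index range -/

/-- Enlarging an index range with an indicator: `Σ_{x ∈ I} f x = Σ_{x ∈ J} 𝟙[x ∈ I]·f x` for `I ⊆ J`. [folklore] -/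
theorem sum_eq_sum_ite_of_subset {κ M : Type*} [AddCommMonoid M] [DecidableEq κ] {I J : Finset κ} (h : I ⊆ J)
    (f : κ → M) : ∑ x ∈ I, f x = ∑ x ∈ J, (if x ∈ I then f x else 0) := by
  rw [Finset.sum_ite_mem, Finset.inter_eq_right.2 h]

/-- **Level sum outside → inside**: `Σ_{q ∈ G} Σ_{x ∈ I q} f q x = Σ_{x ∈ J} Σ_{q ∈ G} 𝟙[x ∈ I q]·f q x` whenever every
`I q ⊆ J` (`q ∈ G`). [folklore] -/
theorem sum_sum_eq_sum_sum_ite_of_subset {κ M : Type*} [AddCommMonoid M] [DecidableEq κ] (G : Finset ℕ)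
    (I : ℕ → Finset κ) (J : Finset κ) (hI : ∀ q ∈ G, I q ⊆ J) (f : ℕ → κ → M) :
    ∑ q ∈ G, ∑ x ∈ I q, f q x = ∑ x ∈ J, ∑ q ∈ G, (if x ∈ I q then f q x else 0) := by
  rw [Finset.sum_congr rfl fun q hq ↦ sum_eq_sum_ite_of_subset (hI q hq) (f q), Finset.sum_comm]

/-- The same with the indicator as a filter on the levels: `Σ_{q ∈ G} Σ_{x ∈ I q} f q x = Σ_{x ∈ J} Σ_{q ∈ G, x ∈ I q} f q x`.
[folklore] -/
theorem sum_sum_eq_sum_sum_filter_of_subset {κ M : Type*} [AddCommMonoid M] [DecidableEq κ] (G : Finset ℕ)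
    (I : ℕ → Finset κ) (J : Finset κ) (hI : ∀ q ∈ G, I q ⊆ J) (f : ℕ → κ → M) :
    ∑ q ∈ G, ∑ x ∈ I q, f q x = ∑ x ∈ J, ∑ q ∈ G.filter (fun q ↦ x ∈ I q), f q x := by
  rw [sum_sum_eq_sum_sum_ite_of_subset G I J hI f]
  exact Finset.sum_congr rfl fun x _ ↦ (Finset.sum_filter _ _).symm

/-- The `−re(P·S)` shape of the core summed over levels: `Σ_q −re(P q·S q) = −re(Σ_q P q·S q)`. [folklore] -/
theorem sum_neg_re_mul (G : Finset ℕ) (P S : ℕ → ℂ) :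
    ∑ q ∈ G, -((P q * S q).re) = -((∑ q ∈ G, P q * S q).re) := by
  rw [Complex.re_sum, ← Finset.sum_neg_distrib]

/-! ### The nest of the finite core -/

/-- **One level: the core nest over the `q`-ranges equals the nest over the `Q`-ranges of the indicator-weighted summand**
(`1 ≤ q ≤ Q`, `Δ′ ≥ 0`; abstract coefficient `C(l,m)` and cell `T(r,l,m,d₁,d₂,i)`):
`Σ_{r<q⁷} Σ_{l,m ≤ ⌊q̂(q)^{Δ′}⌋} C·Σ_{d₁∣l,d₂∣m} Σ_{i ∈ nearBoxes q d (log q)⁴} T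
 = Σ_{r<Q⁷} Σ_{l,m ≤ ⌊q̂(Q)^{Δ′}⌋} Σ_{d₁∣l,d₂∣m} Σ_{i ∈ nearBoxes Q d (log Q)⁴} 𝟙[r<q⁷ ∧ l,m ≤ ⌊q̂(q)^{Δ′}⌋ ∧ i ∈ nearBoxes q d (log q)⁴]·C·T`.
[folklore] -/
theorem coreNest_eq_enlarged {q Q : ℕ} (hq : 1 ≤ q) (hqQ : q ≤ Q) {Δ' : ℝ} (hΔ : 0 ≤ Δ')
    (C : ℕ → ℕ → ℂ) (T : ℕ → ℕ → ℕ → ℕ → ℕ → ℕ × ℕ → ℂ) :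
    ∑ r ∈ Finset.range (q ^ 7), ∑ l ∈ Finset.Icc 1 ⌊qhat q ^ Δ'⌋₊, ∑ m ∈ Finset.Icc 1 ⌊qhat q ^ Δ'⌋₊,
        C l m * ∑ d₁ ∈ l.divisors, ∑ d₂ ∈ m.divisors, ∑ i ∈ nearBoxes q d₁ d₂ (Real.log q ^ 4),
          T r l m d₁ d₂ i =
      ∑ r ∈ Finset.range (Q ^ 7), ∑ l ∈ Finset.Icc 1 ⌊qhat Q ^ Δ'⌋₊, ∑ m ∈ Finset.Icc 1 ⌊qhat Q ^ Δ'⌋₊,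
        ∑ d₁ ∈ l.divisors, ∑ d₂ ∈ m.divisors, ∑ i ∈ nearBoxes Q d₁ d₂ (Real.log Q ^ 4),
          (if r < q ^ 7 ∧ l ≤ ⌊qhat q ^ Δ'⌋₊ ∧ m ≤ ⌊qhat q ^ Δ'⌋₊ ∧ i ∈ nearBoxes q d₁ d₂ (Real.log q ^ 4)
            then C l m * T r l m d₁ d₂ i else 0) := by
  set g : ℕ → ℕ → ℕ → ℕ → ℕ → ℕ × ℕ → ℂ := fun r l m d₁ d₂ i ↦
    if r < q ^ 7 ∧ l ≤ ⌊qhat q ^ Δ'⌋₊ ∧ m ≤ ⌊qhat q ^ Δ'⌋₊ ∧ i ∈ nearBoxes q d₁ d₂ (Real.log q ^ 4)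
      then C l m * T r l m d₁ d₂ i else 0 with hg
  -- the vanishing of `g` outside the `q`-ranges
  have g_of_not {r l m d₁ d₂ : ℕ} {i : ℕ × ℕ}
      (h : ¬ (r < q ^ 7 ∧ l ≤ ⌊qhat q ^ Δ'⌋₊ ∧ m ≤ ⌊qhat q ^ Δ'⌋₊ ∧ i ∈ nearBoxes q d₁ d₂ (Real.log q ^ 4))) :
      g r l m d₁ d₂ i = 0 := by
    simp only [hg]; rw [if_neg h]
  -- Step 1: on the `q`-ranges the summand IS `C·T`, and the innermost range enlarges
  have step1 : ∀ r ∈ Finset.range (q ^ 7), ∀ l ∈ Finset.Icc 1 ⌊qhat q ^ Δ'⌋₊, ∀ m ∈ Finset.Icc 1 ⌊qhat q ^ Δ'⌋₊,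
      C l m * ∑ d₁ ∈ l.divisors, ∑ d₂ ∈ m.divisors, ∑ i ∈ nearBoxes q d₁ d₂ (Real.log q ^ 4), T r l m d₁ d₂ i =
        ∑ d₁ ∈ l.divisors, ∑ d₂ ∈ m.divisors, ∑ i ∈ nearBoxes Q d₁ d₂ (Real.log Q ^ 4), g r l m d₁ d₂ i := by
    intro r hr l hl m hm
    rw [Finset.mul_sum]
    refine Finset.sum_congr rfl fun d₁ _ ↦ ?_
    rw [Finset.mul_sum]
    refine Finset.sum_congr rfl fun d₂ _ ↦ ?_
    rw [Finset.mul_sum]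
    refine (Finset.sum_congr rfl fun i hi ↦ ?_).trans
      (Finset.sum_subset (nearBoxes_log_subset hq hqQ d₁ d₂) fun i _ hi ↦ g_of_not fun h ↦ hi h.2.2.2)
    simp only [hg]
    rw [if_pos ⟨Finset.mem_range.1 hr, (Finset.mem_Icc.1 hl).2, (Finset.mem_Icc.1 hm).2, hi⟩]
  rw [Finset.sum_congr rfl fun r hr ↦ Finset.sum_congr rfl fun l hl ↦ Finset.sum_congr rfl fun m hm ↦
    step1 r hr l hl m hm]
  -- Step 2: enlarge `m`, then `l`, then `r` (extra indices contribute `0`)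
  have hL := Icc_floor_qhat_rpow_subset hqQ hΔ
  calc ∑ r ∈ Finset.range (q ^ 7), ∑ l ∈ Finset.Icc 1 ⌊qhat q ^ Δ'⌋₊, ∑ m ∈ Finset.Icc 1 ⌊qhat q ^ Δ'⌋₊,
          ∑ d₁ ∈ l.divisors, ∑ d₂ ∈ m.divisors, ∑ i ∈ nearBoxes Q d₁ d₂ (Real.log Q ^ 4), g r l m d₁ d₂ i
      = ∑ r ∈ Finset.range (q ^ 7), ∑ l ∈ Finset.Icc 1 ⌊qhat q ^ Δ'⌋₊, ∑ m ∈ Finset.Icc 1 ⌊qhat Q ^ Δ'⌋₊,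
          ∑ d₁ ∈ l.divisors, ∑ d₂ ∈ m.divisors, ∑ i ∈ nearBoxes Q d₁ d₂ (Real.log Q ^ 4), g r l m d₁ d₂ i := by
        refine Finset.sum_congr rfl fun r _ ↦ Finset.sum_congr rfl fun l _ ↦
          Finset.sum_subset hL fun m hmQ hmq ↦ ?_
        have hm : ¬ m ≤ ⌊qhat q ^ Δ'⌋₊ := fun h ↦ hmq (Finset.mem_Icc.2 ⟨(Finset.mem_Icc.1 hmQ).1, h⟩)
        exact Finset.sum_eq_zero fun d₁ _ ↦ Finset.sum_eq_zero fun d₂ _ ↦ Finset.sum_eq_zero fun i _ ↦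
          g_of_not fun h ↦ hm h.2.2.1
    _ = ∑ r ∈ Finset.range (q ^ 7), ∑ l ∈ Finset.Icc 1 ⌊qhat Q ^ Δ'⌋₊, ∑ m ∈ Finset.Icc 1 ⌊qhat Q ^ Δ'⌋₊,
          ∑ d₁ ∈ l.divisors, ∑ d₂ ∈ m.divisors, ∑ i ∈ nearBoxes Q d₁ d₂ (Real.log Q ^ 4), g r l m d₁ d₂ i := by
        refine Finset.sum_congr rfl fun r _ ↦ Finset.sum_subset hL fun l hlQ hlq ↦ ?_
        have hl : ¬ l ≤ ⌊qhat q ^ Δ'⌋₊ := fun h ↦ hlq (Finset.mem_Icc.2 ⟨(Finset.mem_Icc.1 hlQ).1, h⟩)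
        exact Finset.sum_eq_zero fun m _ ↦ Finset.sum_eq_zero fun d₁ _ ↦ Finset.sum_eq_zero fun d₂ _ ↦
          Finset.sum_eq_zero fun i _ ↦ g_of_not fun h ↦ hl h.2.1
    _ = ∑ r ∈ Finset.range (Q ^ 7), ∑ l ∈ Finset.Icc 1 ⌊qhat Q ^ Δ'⌋₊, ∑ m ∈ Finset.Icc 1 ⌊qhat Q ^ Δ'⌋₊,
          ∑ d₁ ∈ l.divisors, ∑ d₂ ∈ m.divisors, ∑ i ∈ nearBoxes Q d₁ d₂ (Real.log Q ^ 4), g r l m d₁ d₂ i := by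
        refine Finset.sum_subset (range_pow_subset hqQ 7) fun r _ hrq ↦ ?_
        have hr : ¬ r < q ^ 7 := fun h ↦ hrq (Finset.mem_range.2 h)
        exact Finset.sum_eq_zero fun l _ ↦ Finset.sum_eq_zero fun m _ ↦ Finset.sum_eq_zero fun d₁ _ ↦
          Finset.sum_eq_zero fun d₂ _ ↦ Finset.sum_eq_zero fun i _ ↦ g_of_not fun h ↦ hr h.1

/-- **Exchange of the level sum with a q-free nest** (after enlargement): for any finite set of levels `G`, prefactor
`P`, q-free ranges `R, L` and near-box range `NB d₁ d₂`, and any summand `g`,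
`Σ_{q∈G} −re(P q·Σ_{r<R} Σ_{l,m ≤ L} Σ_{d₁∣l,d₂∣m} Σ_{i ∈ NB d₁ d₂} g q …) = −re(Σ_{r} Σ_{l,m} Σ_{d} Σ_{i} Σ_{q∈G} P q·g q …)`.
[folklore] -/
theorem sum_levels_coreNest_exchange (G : Finset ℕ) (P : ℕ → ℂ) (R L : ℕ) (NB : ℕ → ℕ → Finset (ℕ × ℕ))
    (g : ℕ → ℕ → ℕ → ℕ → ℕ → ℕ → ℕ × ℕ → ℂ) :
    ∑ q ∈ G, -((P q * ∑ r ∈ Finset.range R, ∑ l ∈ Finset.Icc 1 L, ∑ m ∈ Finset.Icc 1 L,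
        ∑ d₁ ∈ l.divisors, ∑ d₂ ∈ m.divisors, ∑ i ∈ NB d₁ d₂, g q r l m d₁ d₂ i).re) =
      -((∑ r ∈ Finset.range R, ∑ l ∈ Finset.Icc 1 L, ∑ m ∈ Finset.Icc 1 L,
          ∑ d₁ ∈ l.divisors, ∑ d₂ ∈ m.divisors, ∑ i ∈ NB d₁ d₂, ∑ q ∈ G, P q * g q r l m d₁ d₂ i).re) := by
  rw [sum_neg_re_mul]
  congr 2
  simp_rw [Finset.mul_sum]
  rw [Finset.sum_comm]
  refine Finset.sum_congr rfl fun r _ ↦ ?_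
  rw [Finset.sum_comm]
  refine Finset.sum_congr rfl fun l _ ↦ ?_
  rw [Finset.sum_comm]
  refine Finset.sum_congr rfl fun m _ ↦ ?_
  rw [Finset.sum_comm]
  refine Finset.sum_congr rfl fun d₁ _ ↦ ?_
  rw [Finset.sum_comm]
  refine Finset.sum_congr rfl fun d₂ _ ↦ ?_
  rw [Finset.sum_comm]

/-- **The finite core of a block with the level sum innermost.** For a finite set of levels `G` with `1 ≤ q ≤ Q` on `G`
(`Q = 2N` for a block), `Δ′ ≥ 0`, and per-level prefactor `P q`, coefficients `C q l m`, cells `T q r l m d₁ d₂ i`: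
`Σ_{q∈G} −re(P q·Σ_{r<q⁷} Σ_{l,m ≤ ⌊q̂(q)^{Δ′}⌋} C q l m·Σ_{d₁∣l,d₂∣m} Σ_{i ∈ nearBoxes q d (log q)⁴} T q …)
 = −re(Σ_{r<Q⁷} Σ_{l,m ≤ ⌊q̂(Q)^{Δ′}⌋} Σ_{d₁∣l,d₂∣m} Σ_{i ∈ nearBoxes Q d (log Q)⁴} Σ_{q∈G}
      𝟙[r<q⁷ ∧ l,m ≤ ⌊q̂(q)^{Δ′}⌋ ∧ i ∈ nearBoxes q d (log q)⁴]·P q·C q l m·T q …)` — `offDiagCore` (`P q = 2q̂(2π/q)`,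
`C = c_l c_m`, `T` = the truncated dual series) and `OffDiagCoreSplit.levelBody` instantiate it by unfolding.
[cite: KowalskiMichelVanderKam2000, §6 p. 19, (21)–(23) p. 12 — derivation] -/
theorem sum_levels_coreNest_eq_enlarged (G : Finset ℕ) {Q : ℕ} (hG : ∀ q ∈ G, 1 ≤ q ∧ q ≤ Q) {Δ' : ℝ}
    (hΔ : 0 ≤ Δ') (P : ℕ → ℂ) (C : ℕ → ℕ → ℕ → ℂ) (T : ℕ → ℕ → ℕ → ℕ → ℕ → ℕ → ℕ × ℕ → ℂ) :
    ∑ q ∈ G, -((P q * ∑ r ∈ Finset.range (q ^ 7), ∑ l ∈ Finset.Icc 1 ⌊qhat q ^ Δ'⌋₊,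
        ∑ m ∈ Finset.Icc 1 ⌊qhat q ^ Δ'⌋₊, C q l m * ∑ d₁ ∈ l.divisors, ∑ d₂ ∈ m.divisors,
          ∑ i ∈ nearBoxes q d₁ d₂ (Real.log q ^ 4), T q r l m d₁ d₂ i).re) =
      -((∑ r ∈ Finset.range (Q ^ 7), ∑ l ∈ Finset.Icc 1 ⌊qhat Q ^ Δ'⌋₊, ∑ m ∈ Finset.Icc 1 ⌊qhat Q ^ Δ'⌋₊,
          ∑ d₁ ∈ l.divisors, ∑ d₂ ∈ m.divisors, ∑ i ∈ nearBoxes Q d₁ d₂ (Real.log Q ^ 4), ∑ q ∈ G,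
            (if r < q ^ 7 ∧ l ≤ ⌊qhat q ^ Δ'⌋₊ ∧ m ≤ ⌊qhat q ^ Δ'⌋₊ ∧ i ∈ nearBoxes q d₁ d₂ (Real.log q ^ 4)
              then P q * (C q l m * T q r l m d₁ d₂ i) else 0)).re) := by
  rw [Finset.sum_congr rfl fun q hq ↦ by rw [coreNest_eq_enlarged (hG q hq).1 (hG q hq).2 hΔ (C q) (T q)],
    sum_levels_coreNest_exchange]
  simp_rw [mul_ite, mul_zero]

/-- The same with the indicator as a FILTER on the levels — for a fixed q-free index the inner sum is a sum over the
levels `q ∈ G` whose ranges contain the index (the shape `levelAPSum`-type consumers want). [folklore] -/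
theorem sum_levels_coreNest_eq_enlarged_filter (G : Finset ℕ) {Q : ℕ} (hG : ∀ q ∈ G, 1 ≤ q ∧ q ≤ Q) {Δ' : ℝ}
    (hΔ : 0 ≤ Δ') (P : ℕ → ℂ) (C : ℕ → ℕ → ℕ → ℂ) (T : ℕ → ℕ → ℕ → ℕ → ℕ → ℕ → ℕ × ℕ → ℂ) :
    ∑ q ∈ G, -((P q * ∑ r ∈ Finset.range (q ^ 7), ∑ l ∈ Finset.Icc 1 ⌊qhat q ^ Δ'⌋₊,
        ∑ m ∈ Finset.Icc 1 ⌊qhat q ^ Δ'⌋₊, C q l m * ∑ d₁ ∈ l.divisors, ∑ d₂ ∈ m.divisors,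
          ∑ i ∈ nearBoxes q d₁ d₂ (Real.log q ^ 4), T q r l m d₁ d₂ i).re) =
      -((∑ r ∈ Finset.range (Q ^ 7), ∑ l ∈ Finset.Icc 1 ⌊qhat Q ^ Δ'⌋₊, ∑ m ∈ Finset.Icc 1 ⌊qhat Q ^ Δ'⌋₊,
          ∑ d₁ ∈ l.divisors, ∑ d₂ ∈ m.divisors, ∑ i ∈ nearBoxes Q d₁ d₂ (Real.log Q ^ 4),
            ∑ q ∈ G.filter (fun q ↦ r < q ^ 7 ∧ l ≤ ⌊qhat q ^ Δ'⌋₊ ∧ m ≤ ⌊qhat q ^ Δ'⌋₊ ∧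
                i ∈ nearBoxes q d₁ d₂ (Real.log q ^ 4)),
              P q * (C q l m * T q r l m d₁ d₂ i)).re) := by
  rw [sum_levels_coreNest_eq_enlarged G hG hΔ P C T]
  simp_rw [Finset.sum_filter]

/-- **Block form**: for `G ⊆ goodPrimes Δ′ N` the hypothesis `1 ≤ q ≤ 2N` on `G` holds, so the enlargement is to the
ranges at `Q = 2N`. [cite: KowalskiMichelVanderKam2000, §2 p. 7 (M ∉ ℤ) — derivation] -/
theorem levels_le_two_mul_of_subset_goodPrimes {Δ' : ℝ} {N : ℕ} {G : Finset ℕ} (hG : G ⊆ goodPrimes Δ' N) :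
    ∀ q ∈ G, 1 ≤ q ∧ q ≤ 2 * N :=
  fun _ hq ↦ one_le_and_le_two_mul_of_mem_goodPrimes (hG hq)

/-! ### rev 2 — the instance on `OffDiagCoreSplit.coreWith` (hence `coreP`, `coreS R`, `coreL R`) -/

/-- **The switched block core with the level sum innermost.** For levels `G` with `1 ≤ q ≤ Q` on `G` (`Q = 2N` for
`G ⊆ goodPrimes Δ′ N`, `levels_le_two_mul_of_subset_goodPrimes`) and `Δ′ ≥ 0`, prover-6's `coreWith K G Hf Δ′`
(`= Σ_{q∈G} levelBody q Δ′ (switchedCell K Hf q)`; `coreP`/`coreS R`/`coreL R` are its instances at the three level kernels)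
equals the q-free nest at level `Q` of `Σ_{q∈G} 𝟙[r < q⁷ ∧ l,m ≤ ⌊q̂(q)^{Δ′}⌋ ∧ i ∈ nearBoxes q d (log q)⁴]·2q̂(2π/q)·c_l(q)c_m(q)·
switchedCell K Hf q r l m d₁ d₂ i` — for each fixed `(r,l,m,d₁,d₂,i)` (and, inside the cell, `(h₁,s)`) the level `q` now runs
innermost, against the kernel `K … q` (`levelPrincipal/levelSmallPart/levelLargePart {q} 1 …`).
[cite: KowalskiMichelVanderKam2000, §6 p. 19, (21)–(23) p. 12 — derivation] -/
theorem coreWith_eq_enlarged (K : ℕ → ℤ → ℤ → ℤ → ℕ → ℂ) (G : Finset ℕ) {Q : ℕ} (hG : ∀ q ∈ G, 1 ≤ q ∧ q ≤ Q)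
    (Hf : ℕ → ℕ → ℕ → ℕ → ℕ → ℕ → ℕ × ℕ → ℕ) {Δ' : ℝ} (hΔ : 0 ≤ Δ') :
    coreWith K G Hf Δ' =
      -((∑ r ∈ Finset.range (Q ^ 7), ∑ l ∈ Finset.Icc 1 ⌊qhat Q ^ Δ'⌋₊, ∑ m ∈ Finset.Icc 1 ⌊qhat Q ^ Δ'⌋₊,
          ∑ d₁ ∈ l.divisors, ∑ d₂ ∈ m.divisors, ∑ i ∈ nearBoxes Q d₁ d₂ (Real.log Q ^ 4), ∑ q ∈ G,
            (if r < q ^ 7 ∧ l ≤ ⌊qhat q ^ Δ'⌋₊ ∧ m ≤ ⌊qhat q ^ Δ'⌋₊ ∧ i ∈ nearBoxes q d₁ d₂ (Real.log q ^ 4)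
              then 2 * (qhat q : ℂ) * (2 * π / q) *
                ((((mollifierCoeff (X ^ 2) (qhat q ^ Δ') l * mollifierCoeff (X ^ 2) (qhat q ^ Δ') m : ℝ) : ℂ)) *
                  switchedCell K Hf q r l m d₁ d₂ i)
              else 0)).re) := by
  unfold coreWith
  trans ∑ q ∈ G, -((2 * (qhat q : ℂ) * (2 * π / q) *
      ∑ r ∈ Finset.range (q ^ 7), ∑ l ∈ Finset.Icc 1 ⌊qhat q ^ Δ'⌋₊, ∑ m ∈ Finset.Icc 1 ⌊qhat q ^ Δ'⌋₊,
        (((mollifierCoeff (X ^ 2) (qhat q ^ Δ') l * mollifierCoeff (X ^ 2) (qhat q ^ Δ') m : ℝ) : ℂ)) *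
          ∑ d₁ ∈ l.divisors, ∑ d₂ ∈ m.divisors, ∑ i ∈ nearBoxes q d₁ d₂ (Real.log q ^ 4),
            switchedCell K Hf q r l m d₁ d₂ i).re)
  · refine Finset.sum_congr rfl fun q hq ↦ ?_
    have hq0 : q ≠ 0 := by have := (hG q hq).1; omega
    rw [dif_neg hq0]
    rfl
  · exact sum_levels_coreNest_eq_enlarged G hG hΔ (fun q ↦ 2 * (qhat q : ℂ) * (2 * π / q))
      (fun q l m ↦ (((mollifierCoeff (X ^ 2) (qhat q ^ Δ') l * mollifierCoeff (X ^ 2) (qhat q ^ Δ') m : ℝ) : ℂ)))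
      (fun q ↦ switchedCell K Hf q)

/-- **`coreL R` (a8R) with the level sum innermost** — the instance L7d part 2 consumes: kernel
`levelLargePart R {q} 1 (switchMod c s h₁) (switchClass c A s h₁)`. [cite: KowalskiMichelVanderKam2000, §6 p. 19 — derivation;
Davenport1980, ch. 29 — derivation] -/
theorem coreL_eq_enlarged (R : ℕ) (G : Finset ℕ) {Q : ℕ} (hG : ∀ q ∈ G, 1 ≤ q ∧ q ≤ Q)
    (Hf : ℕ → ℕ → ℕ → ℕ → ℕ → ℕ → ℕ × ℕ → ℕ) {Δ' : ℝ} (hΔ : 0 ≤ Δ') :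
    coreL R G Hf Δ' =
      -((∑ r ∈ Finset.range (Q ^ 7), ∑ l ∈ Finset.Icc 1 ⌊qhat Q ^ Δ'⌋₊, ∑ m ∈ Finset.Icc 1 ⌊qhat Q ^ Δ'⌋₊,
          ∑ d₁ ∈ l.divisors, ∑ d₂ ∈ m.divisors, ∑ i ∈ nearBoxes Q d₁ d₂ (Real.log Q ^ 4), ∑ q ∈ G,
            (if r < q ^ 7 ∧ l ≤ ⌊qhat q ^ Δ'⌋₊ ∧ m ≤ ⌊qhat q ^ Δ'⌋₊ ∧ i ∈ nearBoxes q d₁ d₂ (Real.log q ^ 4)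
              then 2 * (qhat q : ℂ) * (2 * π / q) *
                ((((mollifierCoeff (X ^ 2) (qhat q ^ Δ') l * mollifierCoeff (X ^ 2) (qhat q ^ Δ') m : ℝ) : ℂ)) *
                  switchedCell (fun c A s h₁ q ↦ levelLargePart R {q} (fun _ ↦ (1 : ℂ)) (switchMod c s h₁)
                    (switchClass c A s h₁)) Hf q r l m d₁ d₂ i)
              else 0)).re) :=
  coreWith_eq_enlarged _ G hG Hf hΔ

/-- **`coreP` (a8P) with the level sum innermost** (kernel `levelPrincipal {q} 1 (switchMod c s h₁)`).
[cite: KowalskiMichelVanderKam2000, §6 p. 19 — derivation] -/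
theorem coreP_eq_enlarged (G : Finset ℕ) {Q : ℕ} (hG : ∀ q ∈ G, 1 ≤ q ∧ q ≤ Q)
    (Hf : ℕ → ℕ → ℕ → ℕ → ℕ → ℕ → ℕ × ℕ → ℕ) {Δ' : ℝ} (hΔ : 0 ≤ Δ') :
    coreP G Hf Δ' =
      -((∑ r ∈ Finset.range (Q ^ 7), ∑ l ∈ Finset.Icc 1 ⌊qhat Q ^ Δ'⌋₊, ∑ m ∈ Finset.Icc 1 ⌊qhat Q ^ Δ'⌋₊,
          ∑ d₁ ∈ l.divisors, ∑ d₂ ∈ m.divisors, ∑ i ∈ nearBoxes Q d₁ d₂ (Real.log Q ^ 4), ∑ q ∈ G,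
            (if r < q ^ 7 ∧ l ≤ ⌊qhat q ^ Δ'⌋₊ ∧ m ≤ ⌊qhat q ^ Δ'⌋₊ ∧ i ∈ nearBoxes q d₁ d₂ (Real.log q ^ 4)
              then 2 * (qhat q : ℂ) * (2 * π / q) *
                ((((mollifierCoeff (X ^ 2) (qhat q ^ Δ') l * mollifierCoeff (X ^ 2) (qhat q ^ Δ') m : ℝ) : ℂ)) *
                  switchedCell (fun c _ s h₁ q ↦ levelPrincipal {q} (fun _ ↦ (1 : ℂ)) (switchMod c s h₁))
                    Hf q r l m d₁ d₂ i)
              else 0)).re) :=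
  coreWith_eq_enlarged _ G hG Hf hΔ

/-- **`coreS R` (a8S) with the level sum innermost** (kernel `levelSmallPart R {q} 1 (switchMod …) (switchClass …)`).
[cite: KowalskiMichelVanderKam2000, §6 p. 19 — derivation; Davenport1980, ch. 29 — derivation] -/
theorem coreS_eq_enlarged (R : ℕ) (G : Finset ℕ) {Q : ℕ} (hG : ∀ q ∈ G, 1 ≤ q ∧ q ≤ Q)
    (Hf : ℕ → ℕ → ℕ → ℕ → ℕ → ℕ → ℕ × ℕ → ℕ) {Δ' : ℝ} (hΔ : 0 ≤ Δ') :
    coreS R G Hf Δ' =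
      -((∑ r ∈ Finset.range (Q ^ 7), ∑ l ∈ Finset.Icc 1 ⌊qhat Q ^ Δ'⌋₊, ∑ m ∈ Finset.Icc 1 ⌊qhat Q ^ Δ'⌋₊,
          ∑ d₁ ∈ l.divisors, ∑ d₂ ∈ m.divisors, ∑ i ∈ nearBoxes Q d₁ d₂ (Real.log Q ^ 4), ∑ q ∈ G,
            (if r < q ^ 7 ∧ l ≤ ⌊qhat q ^ Δ'⌋₊ ∧ m ≤ ⌊qhat q ^ Δ'⌋₊ ∧ i ∈ nearBoxes q d₁ d₂ (Real.log q ^ 4)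
              then 2 * (qhat q : ℂ) * (2 * π / q) *
                ((((mollifierCoeff (X ^ 2) (qhat q ^ Δ') l * mollifierCoeff (X ^ 2) (qhat q ^ Δ') m : ℝ) : ℂ)) *
                  switchedCell (fun c A s h₁ q ↦ levelSmallPart R {q} (fun _ ↦ (1 : ℂ)) (switchMod c s h₁)
                    (switchClass c A s h₁)) Hf q r l m d₁ d₂ i)
              else 0)).re) :=
  coreWith_eq_enlarged _ G hG Hf hΔ

end Summit.Parity.GeneralizedHardyLittlewood.Theorems.BeyondDiagonalBeatsQuarter.OffDiag
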